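import Summits.QuantumFields.YangMills.Theorems.BalabanUVNodesN17D4ReadOutAtRecord13
import Summits.QuantumFields.YangMills.Theorems.BalabanUVNodesN18U3TowerGuards

/-!
# BalabanUVNodes ∕ node N17 — THE β-ENCODING SHADOW PASSES THE COUPLING-SENSITIVITY GUARD: what `SensitiveOnBoxes` adds to the (D4)-keyed U3 slots of K3⁷ v2's `PHolderD4`
# (kernel; addendum to `…N17D4ReadOutAtRecord13` p584117 against dag-n18-w2's `…N18U3TowerGuards` p584126)

Cell `pub-ymgap` (HUMAN RULING D-0062 ∕ D-0149), seat `pub-ymgap-dag-n17-w2` (WIDTH SEAT 2 of 3 on node N17 = NE4), generation 0, FILE 2 of W-SEAT-START-LIST §2 n17 ITEM 2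
(«(D4) `ReadOutAt D R.u3` AT THE RECORD u3 … answers plan's (q3) in substance: does `ReadOutAt` exclude the junk functionals?»).  THEOREMS ONLY (0 `def`, 0 `sorry`, standard
axioms); `--kind proof --supports stmt-QuantumFields-20544 --as helper` (K3⁷ `SpineGivenEndpointR13SepCoPH`); count-neutral.  Imports this seat's FILE 1 `…N17D4ReadOutAtRecord13`
(§1 `readOutAt_u3OfRecord₁₃_of_univ`, §3 `u2Inputs_of_readOut_n18_n22_u3OfRecord₁₃`) and dag-n18-w2's `…N18U3TowerGuards` (`YMDAG.N18.U3Guards.BlindOnBoxes ∕ SensitiveOnBoxes ∕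
BoxwiseConstant`, `sensitiveOnBoxes_iff_not_blindOnBoxes`, `sensitiveOnBoxes_of_readOutAt`); modifies nothing; every cited lemma used BY NAME.

WHY.  dag-n18-w2 offers plan g77∕g78 the DISPLAYED guard `SensitiveOnBoxes (u.EA k) θ.γ` («the U3 tower is COUPLING-SENSITIVE over the record's boxes») for the `∃ 𝔯`
slot of K3⁷ v2's `stub_rates13H` (pub-ymgap INBOX l.24158 ∕ LANDED l.≈24510), and proves that under (D4) the guard FOLLOWS from β-nondegeneracy (`sensitiveOnBoxes_of_readOutAt`).
FILE 1 §3 showed that the (D4)-keyed U3 slots over a residual reading are inhabited by the β-ENCODING objects (`T4BetaReadOut.betaCarriers ∕ betaEA ∕ betaEB`) whenever node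
U2's triple holds for the datum's β.  This file closes the square: the β-encoding run-A functional `betaEA β` is BLIND over the γ-boxes IFF `β` is boxwise constant
(`blindOnBoxes_betaEA_iff`), hence SENSITIVE iff `β` is NOT boxwise constant (`sensitiveOnBoxes_betaEA_iff`) — so at every datum whose β is non-degenerate on the boxes the
β-encoding shadow PASSES the guard and still carries `ReadOutAt ∧ N18At ∧ N22At` at every run length (`exists_u3Objects₁₁_sensitive_readOut_n18_n22_of_u2Inputs`, and the
tuple-wise `∃ 𝔯` form `exists_rateReading₁₃CoPH_sensitive_u3Slots_of`).  READING FOR THE PLAN: `PHolderD4 ∧ SensitiveOnBoxes` on the U3 side, `𝔯` residual, books EXACTLY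
«`betaOfRecord₁₃` not boxwise constant on `]0,θ.γ]` ∧ node U2's triple for it» — the guard contributes β-NONDEGENERACY (a statement about the DATUM), nothing about node U3's
functionals; with dag-n18-w2's `sensitiveOnBoxes_of_readOutAt` the guard is moreover REDUNDANT next to (D4) at a non-degenerate β.  The only conjunct that reaches node U3's
content stays R2's BY-NAME pin of `𝔯.lit` to node00-def-W1's reading.

HONEST FRAMING.  Kernel bookkeeping over typed SHAPES; nothing of Bałaban's asserted; (D4) ∕ NE4 ∕ NE5 ∕ NE9 NOT PRINTED beyond the linearity of [Balaban1987RG1] (1.20)–(1.22)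
p. 264 and NOT proved; N17 ∕ N18 NOT discharged; K3⁷ OPEN (v1 stubs untouched, v2 a draft); counts UNMOVED (typed 28∕28 · discharged 5∕27, A 5∕28).  One finite four-torus
programme at fixed ε per run — the Yang–Mills mass gap (Clay) is NOT proved by any of this; R4 closes the conditional finite-𝕋⁴ rung `BalabanLadder.UV` only; nothing
continuum ∕ ℝ⁴ ∕ OS.
-/

noncomputable section

namespace Summit.QuantumFields.YangMills.BalabanUVNodes.N17D4ReadOutGuardShadow

open Literature.MathematicalPhysics.QuantumFieldTheory.Balaban1983to89
open Literature.MathematicalPhysics.QuantumFieldTheory.Balaban1983to89.FlowStep (Box mem_box HBeta)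
open Literature.MathematicalPhysics.QuantumFieldTheory.Balaban1983to89.T4CouplingMatching (ScaleShiftRate HistLipschitz)
open Literature.MathematicalPhysics.QuantumFieldTheory.Balaban1983to89.T4Continuum (T4Family ULoop)
open Literature.MathematicalPhysics.QuantumFieldTheory.Balaban1983to89.T4OutputRate (Carriers Functional Window NE5 NE9)
open Literature.MathematicalPhysics.QuantumFieldTheory.Balaban1983to89.T4BetaReadOut
  (Slice ReadOut extd_mem_window prefix_mem_box betaCarriers betaEA betaEB betaRead representsA_beta representsB_beta readBounded_beta readCovariant_beta
    ne5_beta_of_scaleShiftRate ne9_beta_of_histLipschitz fadingMemory_beta)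
open Literature.MathematicalPhysics.QuantumFieldTheory.Balaban1983to89.T4FlagMemory (extd extd_coe)
open Literature.MathematicalPhysics.QuantumFieldTheory.Balaban1983to89.Node00
  (Stage13Params Stage13HParams datumOfRecord₁₃CoPH betaOfRecord₁₃ βfun_datumOfRecord₁₃CoPH U3Objects₁₁ U3Letters₁₁ RateObjects₁₁)
open Summit.QuantumFields.BalabanUV.T4Continuum.Spine.NE4 (U2Inputs)
open YMDAG.UVSplit
open YMDAG.N18.U3Guards (BlindOnBoxes SensitiveOnBoxes BoxwiseConstant sensitiveOnBoxes_iff_not_blindOnBoxes sensitiveOnBoxes_of_readOutAt)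
open Summit.QuantumFields.YangMills.BalabanUVNodes.N17D4ReadOutAtRecord
  (readOutAt_u3OfRecord₁₃_of_univ u2Inputs_of_readOut_n18_n22_u3OfRecord₁₃)

variable {N : ℕ} [NeZero N] {F : T4Family}

/-! ## §1 The β-encoding run-A functional and the guard: blind ⟺ β boxwise constant -/

/-- The prefix of a padded box history is the history (`extd_coe`, pointwise). [folklore] -/
theorem prefix_extd_eq {k : ℕ} (v : Fin (k + 1) → ℝ) : (fun i : Fin (k + 1) => extd v i) = v :=
  funext fun i => extd_coe v i

/-- **THE β-ENCODING FUNCTIONAL IS BLIND OVER THE γ-BOXES IFF β IS BOXWISE CONSTANT** (kernel): `betaEA β (extd v) () n = β n ((extd v)|ₙ)`; at `n = k` the prefix IS `v`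
(`extd_coe`), so blindness at step `k` is constancy of `β k` on `]0,γ]^{k+1}`; conversely every prefix of a padded box history lies in its box (`prefix_mem_box ∘ extd_mem_window`).
[folklore] -/
theorem blindOnBoxes_betaEA_iff (β : HBeta) (γ : ℝ) : BlindOnBoxes (betaEA β) γ ↔ BoxwiseConstant γ β := by
  constructor
  · intro h k v v' hv hv'
    have := congrFun (congrFun (h k v v' hv hv') PUnit.unit) k
    simpa only [betaEA, prefix_extd_eq] using this
  · intro h k v v' hv hv'
    funext U n
    exact h n _ _ (prefix_mem_box (extd_mem_window hv) n) (prefix_mem_box (extd_mem_window hv') n)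

/-- **… HENCE IT PASSES dag-n18-w2's GUARD IFF β IS NOT BOXWISE CONSTANT** (`sensitiveOnBoxes_iff_not_blindOnBoxes`). [folklore] -/
theorem sensitiveOnBoxes_betaEA_iff (β : HBeta) (γ : ℝ) : SensitiveOnBoxes (betaEA β) γ ↔ ¬ BoxwiseConstant γ β := by
  rw [sensitiveOnBoxes_iff_not_blindOnBoxes, blindOnBoxes_betaEA_iff]

/-! ## §2 At a non-degenerate β the β-encoding shadow passes the guard AND carries the (D4)-keyed U3 slots -/

section Shadow

variable (D : Datum F N) (θ : Stage13Params F N)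

/-- **THE GUARDED β-ENCODING SHADOW (kernel)**: if the datum's β is NOT boxwise constant on `]0,θ.γ]` and node U2's input triple `U2Inputs D c C ρ θ.γ Λ` holds (`0 ≤ c`,
`0 < ρ < 1`), then the β-encoding U3 objects of FILE 1 §3 (level carriers `betaCarriers`, `EA := betaEA D.βfun`, `EB := betaEB D.βfun`, letters `κ 0, θ₅ ρ, C₅ c∕ρ, C₉ C∕ρ, ω ρ,
cr 1, ρ`) are SIGNED, PASS `SensitiveOnBoxes (u.EA k) θ.γ` AT EVERY RUN LENGTH, and carry `ReadOutAt D (u3OfRecord₁₃ θ u k) ∧ N18At (…) ∧ N22At (…)` at every run length — the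
guard sees β-nondegeneracy, not Bałaban's term functionals. [cite: Balaban1987RG1, (1.20)-(1.22) p.264] -/
theorem exists_u3Objects₁₁_sensitive_readOut_n18_n22_of_u2Inputs (hβ : ¬ BoxwiseConstant θ.γ D.βfun) {c C ρ : ℝ} {Λ : ℕ → ℕ → ℝ}
    (hc : 0 ≤ c) (hρ0 : 0 < ρ) (hρ1 : ρ < 1) (h : U2Inputs D c C ρ θ.γ Λ) :
    ∃ u : U3Objects₁₁, u.Signs ∧ (∀ k, SensitiveOnBoxes (u.EA k) θ.γ) ∧
      ∀ k, ReadOutAt D (u3OfRecord₁₃ θ u k) ∧ N18At (u3OfRecord₁₃ θ u k) ∧ N22At (u3OfRecord₁₃ θ u k) := by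
  obtain ⟨hS, hL, hM⟩ := h
  have hC : 0 ≤ C := T4BetaReadOut.fadingMemory_const_nonneg (show T4OutputRate.FadingMemory C ρ Λ from hM)
  let u : U3Objects₁₁ :=
    { κ := 0, θ₅ := ρ, C₅ := c / ρ, C₉ := C / ρ, ω := ρ, cr := 1, ρ := ρ,
      levelCarriers := fun _ => betaCarriers, EA := fun _ => betaEA D.βfun, EB := fun _ => betaEB D.βfun }
  have hs : u.Signs :=
    { κ_nonneg := le_rfl, θ₅_pos := hρ0, θ₅_lt_one := hρ1, C₅_nonneg := div_nonneg hc hρ0.le, C₉_nonneg := div_nonneg hC hρ0.le,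
      ω_nonneg := hρ0.le, ω_lt_one := hρ1, cr_nonneg := zero_le_one, θ₅_le_ρ := le_rfl, ω_le_ρ := le_rfl, ρ_lt_one := hρ1 }
  refine ⟨u, hs, fun _ => (sensitiveOnBoxes_betaEA_iff D.βfun θ.γ).mpr hβ, fun k => ⟨?_, ?_, ?_⟩⟩
  · exact readOutAt_u3OfRecord₁₃_of_univ D θ u k hs (representsA_beta D.βfun θ.γ) (representsB_beta D.βfun θ.γ) readBounded_beta
      readCovariant_beta
  · intro b hb0 hbγ
    exact ne5_beta_of_scaleShiftRate hρ0 hS hb0 hbγ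
  · refine ⟨?_, fadingMemory_u3OfRecord₁₃ θ u k hs⟩
    have hmod := fadingMemory_beta hρ0 hM
    exact YMDAG.N22.ne9_of_moduli_le (fun n i hi => (hmod n i hi.le).2) (ne9_beta_of_histLipschitz hL)

/-- **WHAT `PHolderD4 ∧ SensitiveOnBoxes` BOOKS ON THE U3 SIDE OVER A RESIDUAL READING (kernel `iff`)**: SOME signed U3 objects passing the guard at every run length and
carrying `ReadOutAt ∧ N18At ∧ N22At` at every run length, AT A DATUM WHOSE β IS NOT BOXWISE CONSTANT ⟺ node U2's input triple for the datum's β with SOME letters `0 ≤ c`,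
`0 < ρ < 1`.  (At a boxwise-constant β the guard cannot be met under (D4) by a BLIND tower — dag-n18-w2 `boxwiseConstant_of_readOutAt_blind` — and (D4) is then content-free
anyway, `YMDAG.N18.U3Guards.readOutAt_of_boxwiseConst`.)  So the guard upgrades FILE 1's booking «U2's triple» by «β non-degenerate» — a clause about the DATUM.
[cite: Balaban1987RG1, (1.20)-(1.22) p.264 and §5 p.298] -/
theorem exists_u3Objects₁₁_sensitive_readOut_n18_n22_iff_of_not_boxwiseConstant (hβ : ¬ BoxwiseConstant θ.γ D.βfun) :
    (∃ u : U3Objects₁₁, u.Signs ∧ (∀ k, SensitiveOnBoxes (u.EA k) θ.γ) ∧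
        ∀ k, ReadOutAt D (u3OfRecord₁₃ θ u k) ∧ N18At (u3OfRecord₁₃ θ u k) ∧ N22At (u3OfRecord₁₃ θ u k)) ↔
      ∃ (c C ρ : ℝ) (Λ : ℕ → ℕ → ℝ), 0 ≤ c ∧ 0 < ρ ∧ ρ < 1 ∧ U2Inputs D c C ρ θ.γ Λ := by
  constructor
  · rintro ⟨u, hs, -, h⟩
    obtain ⟨hD4, h18, h22⟩ := h 0
    exact ⟨_, _, _, _, mul_nonneg (mul_nonneg hs.cr_nonneg hs.C₅_nonneg) hs.θ₅_pos.le, hs.θ₅_pos.trans_le hs.θ₅_le_ρ, hs.ρ_lt_one,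
      u2Inputs_of_readOut_n18_n22_u3OfRecord₁₃ D θ u 0 hD4 h18 h22⟩
  · rintro ⟨c, C, ρ, Λ, hc, hρ0, hρ1, h⟩
    exact exists_u3Objects₁₁_sensitive_readOut_n18_n22_of_u2Inputs D θ hβ hc hρ0 hρ1 h

/-- **UNDER (D4) THE GUARD IS AUTOMATIC AT A NON-DEGENERATE β** (dag-n18-w2 `sensitiveOnBoxes_of_readOutAt`, placed at the bundle of record): for EVERY `u : U3Objects₁₁` and run
length `k`, `ReadOutAt D (u3OfRecord₁₃ θ u k)` with `D.βfun` not boxwise constant on `]0,θ.γ]` gives `SensitiveOnBoxes (u.EA k) θ.γ` — adding the guard to `PHolderD4` changes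
nothing at such data. [folklore] -/
theorem sensitiveOnBoxes_of_readOutAt_u3OfRecord₁₃ (u : U3Objects₁₁) (k : ℕ) (hD4 : ReadOutAt D (u3OfRecord₁₃ θ u k))
    (hβ : ¬ BoxwiseConstant θ.γ D.βfun) : SensitiveOnBoxes (u.EA k) θ.γ :=
  sensitiveOnBoxes_of_readOutAt hD4 hβ

end Shadow

/-! ## §3 The tuple-wise `∃ 𝔯` form with the guard, at the Stage-13 CoPH record -/

/-- **THE GUARDED `∃ 𝔯` IS STILL FREE ON THE U3 SIDE (kernel, guard-generic)**: if at every Stage-13 tuple with provisos under the guard `P` the β OF RECORD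
`β₁₃ := betaOfRecord₁₃ F N θ.toStage13Params` is NOT boxwise constant on `]0,θ.γ]` and node U2's triple holds for it with some letters `0 ≤ c`, `0 < ρ < 1`, then there EXISTS a
Stage-13 rate reading `𝔯` whose bundles of record carry, at every such tuple, every `(g₀, os)` and EVERY run length `k`: signed U3 letters, dag-n18-w2's guard
`SensitiveOnBoxes ((𝔯.lit …).u3.EA k) θ.γ`, and `ReadOutAt (datumOfRecord₁₃CoPH F N θ hP) (…).u3 ∧ N18At (…).u3 ∧ N22At (…).u3` (tuple-wise choice of §2's guarded shadow; the
other layers trivial — `Node00.nonempty_rateObjects₁₁`, the empty dressed tower).  So `stub_rates13H` keyed on `PHolderD4 ∧ SensitiveOnBoxes` has, on the U3 side, the content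
«β₁₃ non-degenerate ∧ U2's triple for β₁₃» and no more. [cite: Balaban1987RG1, (1.20)-(1.22) p.264, (2.9) p.266] -/
theorem exists_rateReading₁₃CoPH_sensitive_u3Slots_of (P : (F : T4Family) → (θ : Stage13HParams F N) → θ.Provisos₁₃CoPH F N → Prop)
    (h : ∀ (F : T4Family) (θ : Stage13HParams F N) (hP : θ.Provisos₁₃CoPH F N), P F θ hP →
      ¬ BoxwiseConstant θ.γ (betaOfRecord₁₃ F N θ.toStage13Params) ∧
        ∃ (c C ρ : ℝ) (Λ : ℕ → ℕ → ℝ), 0 ≤ c ∧ 0 < ρ ∧ ρ < 1 ∧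
          ScaleShiftRate c ρ θ.γ (betaOfRecord₁₃ F N θ.toStage13Params) ∧ HistLipschitz Λ θ.γ (betaOfRecord₁₃ F N θ.toStage13Params) ∧
            T4CouplingMatching.FadingMemory C ρ Λ) :
    ∃ 𝔯 : RateReading₁₃CoPH N, ∀ (F : T4Family) (θ : Stage13HParams F N) (hP : θ.Provisos₁₃CoPH F N), P F θ hP →
      ∀ (g₀ : ℕ → ℝ) (os : List (ULoop F)) (k : ℕ),
        ((𝔯.lit F θ hP g₀ os).u3).Signs ∧ SensitiveOnBoxes (((𝔯.lit F θ hP g₀ os).u3).EA k) θ.γ ∧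
        ReadOutAt (datumOfRecord₁₃CoPH F N θ hP) (rateCarriersOfRecord₁₃CoPH 𝔯 F θ hP g₀ os k).u3 ∧
        N18At (rateCarriersOfRecord₁₃CoPH 𝔯 F θ hP g₀ os k).u3 ∧ N22At (rateCarriersOfRecord₁₃CoPH 𝔯 F θ hP g₀ os k).u3 := by
  classical
  have hU : ∀ (F : T4Family) (θ : Stage13HParams F N) (hP : θ.Provisos₁₃CoPH F N), P F θ hP →
      ∃ u : U3Objects₁₁, u.Signs ∧ (∀ k, SensitiveOnBoxes (u.EA k) θ.γ) ∧
        ∀ k, ReadOutAt (datumOfRecord₁₃CoPH F N θ hP) (u3OfRecord₁₃ θ.toStage13Params u k) ∧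
          N18At (u3OfRecord₁₃ θ.toStage13Params u k) ∧ N22At (u3OfRecord₁₃ θ.toStage13Params u k) := by
    intro F θ hP hθ
    obtain ⟨hβ, c, C, ρ, Λ, hc, hρ0, hρ1, hS, hL, hM⟩ := h F θ hP hθ
    have hβ' : ¬ BoxwiseConstant θ.γ (datumOfRecord₁₃CoPH F N θ hP).βfun := by rwa [βfun_datumOfRecord₁₃CoPH]
    have hI : U2Inputs (datumOfRecord₁₃CoPH F N θ hP) c C ρ θ.γ Λ := by
      simp only [U2Inputs, βfun_datumOfRecord₁₃CoPH]; exact ⟨hS, hL, hM⟩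
    exact exists_u3Objects₁₁_sensitive_readOut_n18_n22_of_u2Inputs _ θ.toStage13Params hβ' hc hρ0 hρ1 hI
  let o₀ : RateObjects₁₁ N := Classical.choice (Node00.nonempty_rateObjects₁₁ N)
  let lit : (F : T4Family) → (θ : Stage13HParams F N) → θ.Provisos₁₃CoPH F N → (ℕ → ℝ) → List (ULoop F) → RateObjects₁₁ N :=
    fun F θ hP _ _ => if hθ : P F θ hP then { o₀ with u3 := Classical.choose (hU F θ hP hθ) } else o₀
  let ne1 : (F : T4Family) → (θ : Stage13HParams F N) → θ.Provisos₁₃CoPH F N → (ℕ → ℝ) → List (ULoop F) → NE1pCarriers :=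
    fun _ _ _ _ _ => ⟨PEmpty, ⟨fun p => p.elim, fun p => p.elim, fun p => p.elim⟩, 0⟩
  refine ⟨⟨lit, ne1⟩, fun F θ hP hθ g₀ os k => ?_⟩
  have hlit : (lit F θ hP g₀ os).u3 = Classical.choose (hU F θ hP hθ) := by
    simp only [lit, dif_pos hθ]
  obtain ⟨hs, hsens, hall⟩ := Classical.choose_spec (hU F θ hP hθ)
  show (lit F θ hP g₀ os).u3.Signs ∧ SensitiveOnBoxes ((lit F θ hP g₀ os).u3.EA k) θ.γ ∧
    ReadOutAt _ (u3OfRecord₁₃ θ.toStage13Params (lit F θ hP g₀ os).u3 k) ∧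
      N18At (u3OfRecord₁₃ θ.toStage13Params (lit F θ hP g₀ os).u3 k) ∧ N22At (u3OfRecord₁₃ θ.toStage13Params (lit F θ hP g₀ os).u3 k)
  rw [hlit]
  exact ⟨hs, hsens k, hall k⟩

end Summit.QuantumFields.YangMills.BalabanUVNodes.N17D4ReadOutGuardShadow

end
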